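import Literature.NumberTheory.GaloisRepresentations.LocalDualityTwoZero
import Literature.NumberTheory.GaloisRepresentations.LocalEulerPoincareCharacteristic
import Mathlib.Algebra.Module.ZMod
import Mathlib.Algebra.Field.ZMod
import Mathlib.LinearAlgebra.Dual.Lemmas
import Mathlib.FieldTheory.Finiteness
import Mathlib.RingTheory.Ideal.Quotient.Index
import HarnessLib

/-!
# A uniform bound `#H¹(F, M) ≤ |M|^{c_F + 2}` for finite `p`-torsion Galois modules over a
# `p`-adic local field (from Tate's local Euler–Poincaré characteristic and local duality)

Topic `NumberTheory/GaloisRepresentations`; namespace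
`Literature.NumberTheory.GaloisRepresentations`.  THEOREMS ONLY (no definition, no named fact).

Let `F` be a non-archimedean local field of characteristic `0`, `Γ_F = Gal(F̄/F)`, and let `M` be a
finite discrete `Γ_F`-module killed by a prime `ℓ` (GIVEN Tate's local Euler–Poincaré characteristic
formula for `F` as the hypothesis `hEP`).  Tate's local Euler–Poincaré characteristic
formula (Milne, *ADT* I Thm. 2.8; Serre, *Galois Cohomology* II §5.7 Thm. 5) — the tree's named
fact `localEulerPoincareCharacteristic F` (`LocalEulerPoincareCharacteristic.lean`), carried here
as a HYPOTHESIS `hEP` (it is PROVED in the tree, but Summits-side: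
`localEulerPoincareCharacteristic_holds` in
`Summits/BirchSwinnertonDyer/Rank1Residual/GaloisImage/LocalEulerPoincareCharacteristicHolds.lean`,
which a Literature file may not import; consumers discharge `hEP` there) — reads
`#H⁰(F,M) · #H²(F,M) · #(𝒪_F/|M|𝒪_F) = #H¹(F,M)`; local Tate duality in bidegree `(2,0)`
(tree `natCard_two_eq_natCard_invariants_homRep`, Serre II §5.2 Thm. 2) gives
`#H²(F,M) = #Hom_{Γ_F}(M, μ_ℓ) ≤ #Hom(M, μ_ℓ) = |M|`.  Hence the **uniform bound**

  `#H¹(F, M) ≤ |M| · |M| · #(𝒪_F / |M| 𝒪_F) ≤ |M| ^ (c_F + 2)`,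
  `c_F := #(𝒪_F / p 𝒪_F)`, `p` the residue characteristic

(`natCard_continuousCohomology_one_le_pow`; for `|M| = ℓᵃ`, `#(𝒪_F/ℓᵃ) = #(𝒪_F/ℓ)ᵃ` is `1` if
`ℓ ≠ p` and `c_Fᵃ ≤ (pᵃ)^{c_F}` if `ℓ = p`).  This is the numerical input of the Gaschütz-lifting
proof that `Γ_F` is topologically finitely generated
(`Literature/AnabelianGeometry/AbsoluteAnabelian/MLFGaloisFiniteQuotientGenerators.lean`); the
exponent `c_F + 2` is crude but uniform in `M`, which is all that proof needs.

## References

* J. S. Milne, *Arithmetic Duality Theorems*, 2nd ed. (2006), I §2 Thm. 2.8, Cor. 2.3.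
  [MilneADT2006]
* J.-P. Serre, *Galois Cohomology* (1997), II §5.2 Thm. 2, §5.7 Thm. 5. [SerreGaloisCohomology1997]
-/

noncomputable section

open CategoryTheory Function
open Field IsNonarchimedeanLocalField ValuativeRel

universe u

namespace Literature.NumberTheory.GaloisRepresentations

open _root_.TopRep _root_.ContRepresentation _root_.ContinuousCohomology DiscreteGaloisModule

/-! ### Counting `𝒪_F / ℓᵃ 𝒪_F` -/

section IntegerQuotient

/-- `#(R ⧸ (ab)) = #(R ⧸ (a)) · #(R ⧸ (b))` for `a ≠ 0` in a domain `R`: the sequence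
`0 → R/(b) →(·a) R/(ab) → R/(a) → 0` is exact. [folklore] -/
private theorem natCard_quotient_span_singleton_mul {R : Type*} [CommRing R] [IsDomain R] {a : R}
    (ha : a ≠ 0) (b : R) :
    Nat.card (R ⧸ Ideal.span {a * b}) =
      Nat.card (R ⧸ Ideal.span {a}) * Nat.card (R ⧸ Ideal.span {b}) := by
  have hle : Ideal.span {a * b} ≤ Ideal.span {a} := Ideal.span_singleton_le_span_singleton.mpr ⟨b, rfl⟩
  let f : R ⧸ Ideal.span {a * b} →+* R ⧸ Ideal.span {a} := Ideal.Quotient.factor hle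
  have hf : Surjective f := Ideal.Quotient.factor_surjective hle
  let g : R →+ R ⧸ Ideal.span {a * b} :=
    (Ideal.Quotient.mk (Ideal.span {a * b})).toAddMonoidHom.comp (AddMonoidHom.mulLeft a)
  have hgker : g.ker = (Ideal.span {b}).toAddSubgroup := by
    ext x
    simp only [g, AddMonoidHom.mem_ker, AddMonoidHom.coe_comp, comp_apply, AddMonoidHom.coe_mulLeft,
      RingHom.toAddMonoidHom_eq_coe, AddMonoidHom.coe_coe, Ideal.Quotient.eq_zero_iff_mem,
      Ideal.mem_span_singleton, Submodule.mem_toAddSubgroup]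
    constructor
    · rintro ⟨c, hc⟩
      exact ⟨c, mul_left_cancel₀ ha (by rw [hc, mul_assoc])⟩
    · rintro ⟨c, rfl⟩
      exact ⟨c, by rw [mul_assoc]⟩
  have hgrange : g.range = f.toAddMonoidHom.ker := by
    ext y
    constructor
    · rintro ⟨x, rfl⟩
      simp only [g, f, RingHom.toAddMonoidHom_eq_coe, AddMonoidHom.mem_ker, AddMonoidHom.coe_comp,
        AddMonoidHom.coe_coe, comp_apply, AddMonoidHom.coe_mulLeft, Ideal.Quotient.factor_mk,
        Ideal.Quotient.eq_zero_iff_mem]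
      exact Ideal.mem_span_singleton.mpr ⟨x, rfl⟩
    · intro hy
      obtain ⟨x, rfl⟩ := Ideal.Quotient.mk_surjective y
      simp only [f, RingHom.toAddMonoidHom_eq_coe, AddMonoidHom.mem_ker, AddMonoidHom.coe_coe,
        Ideal.Quotient.factor_mk, Ideal.Quotient.eq_zero_iff_mem, Ideal.mem_span_singleton] at hy
      obtain ⟨c, rfl⟩ := hy
      exact ⟨c, rfl⟩
  have h1 : Nat.card (R ⧸ Ideal.span {a * b}) =
      Nat.card ((R ⧸ Ideal.span {a * b}) ⧸ f.toAddMonoidHom.ker) * Nat.card f.toAddMonoidHom.ker :=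
    AddSubgroup.card_eq_card_quotient_mul_card_addSubgroup _
  have h2 : Nat.card ((R ⧸ Ideal.span {a * b}) ⧸ f.toAddMonoidHom.ker) = Nat.card (R ⧸ Ideal.span {a}) :=
    Nat.card_congr (QuotientAddGroup.quotientKerEquivOfSurjective f.toAddMonoidHom hf).toEquiv
  have h3 : Nat.card f.toAddMonoidHom.ker = Nat.card (R ⧸ Ideal.span {b}) := by
    rw [← hgrange]
    have e := QuotientAddGroup.quotientKerEquivRange g
    rw [← Nat.card_congr e.toEquiv, hgker]
    rfl
  rw [h1, h2, h3]

/-- `#(R ⧸ (cᵃ)) = #(R ⧸ (c))ᵃ` for `c ≠ 0` in a domain `R`. [folklore] -/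
private theorem natCard_quotient_span_singleton_pow {R : Type*} [CommRing R] [IsDomain R] {c : R}
    (hc : c ≠ 0) (a : ℕ) :
    Nat.card (R ⧸ Ideal.span {c ^ a}) = Nat.card (R ⧸ Ideal.span {c}) ^ a := by
  induction a with
  | zero =>
    rw [pow_zero, pow_zero, Ideal.span_singleton_one]
    haveI : Subsingleton (R ⧸ (⊤ : Ideal R)) := Ideal.Quotient.subsingleton_iff.mpr rfl
    exact Nat.card_of_subsingleton (0 : R ⧸ (⊤ : Ideal R))
  | succ a ih => rw [pow_succ', natCard_quotient_span_singleton_mul hc, ih, pow_succ']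

variable (F : Type u) [Field F] [ValuativeRel F] [TopologicalSpace F] [IsNonarchimedeanLocalField F]

/-- `𝒪_F / c 𝒪_F` is finite for `c ≠ 0` (`c𝒪 = 𝔪ᵏ` in the discrete valuation ring `𝒪_F`, whose
residue field is finite; Mathlib `Ideal.finite_quotient_pow`).  Same proof as the tree's
`finite_quotient_span_singleton_integer` (stated there over a `UniformSpace`). [folklore] -/
private theorem finite_integer_quotient_span_singleton {c : 𝒪[F]} (hc : c ≠ 0) :
    Finite (𝒪[F] ⧸ Ideal.span {c}) := by
  haveI : Finite (𝒪[F] ⧸ IsLocalRing.maximalIdeal 𝒪[F]) := inferInstanceAs (Finite 𝓀[F])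
  obtain ⟨π, hπ⟩ := IsDiscreteValuationRing.exists_irreducible 𝒪[F]
  have hs : Ideal.span {c} ≠ ⊥ := by rwa [Ne, Ideal.span_singleton_eq_bot]
  obtain ⟨k, hk⟩ := IsDiscreteValuationRing.ideal_eq_span_pow_irreducible hs hπ
  rw [hk, ← Ideal.span_singleton_pow, ← hπ.maximalIdeal_eq]
  exact Ideal.finite_quotient_pow (IsNoetherian.noetherian _) k

variable [CharZero F]

omit [TopologicalSpace F] [IsNonarchimedeanLocalField F] in
/-- A natural number `n ≠ 0` is nonzero in `𝒪_F` (characteristic `0`). [folklore] -/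
private theorem natCast_integer_ne_zero {n : ℕ} (hn : n ≠ 0) : ((n : ℕ) : 𝒪[F]) ≠ 0 := by
  intro h
  have h' : ((n : 𝒪[F]) : F) = ((0 : 𝒪[F]) : F) := by rw [h]
  have h'' : (n : F) = 0 := by simpa using h'
  exact hn (Nat.cast_eq_zero.mp h'')

omit [CharZero F] in
/-- **`#(𝒪_F / ℓ 𝒪_F) ≤ ℓ ^ c_F`**, `c_F = #(𝒪_F / p 𝒪_F)`, `p` the residue characteristic, for
every prime `ℓ`: if `ℓ ≠ p` then `ℓ` is a unit of `𝒪_F` and the quotient is trivial; if `ℓ = p` the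
left side is `c_F ≤ 2^{c_F} ≤ p^{c_F}`. [folklore] -/
private theorem natCard_integer_quotient_prime_le {ℓ : ℕ} (hℓ : ℓ.Prime) :
    Nat.card (𝒪[F] ⧸ Ideal.span {((ℓ : ℕ) : 𝒪[F])}) ≤
      ℓ ^ Nat.card (𝒪[F] ⧸ Ideal.span {((ringChar 𝓀[F] : ℕ) : 𝒪[F])}) := by
  by_cases h0 : ((ℓ : ℕ) : 𝓀[F]) = 0
  · -- `ℓ` is the residue characteristic
    have hch : ringChar 𝓀[F] = ℓ := CharP.ringChar_of_prime_eq_zero hℓ h0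
    rw [hch]
    exact (Nat.lt_two_pow_self).le.trans (Nat.pow_le_pow_left hℓ.two_le _)
  · -- `ℓ` is a unit of `𝒪_F`: the quotient is trivial
    have hres : IsLocalRing.residue 𝒪[F] ((ℓ : ℕ) : 𝒪[F]) ≠ 0 := by rwa [map_natCast]
    have hu : IsUnit (((ℓ : ℕ) : 𝒪[F])) := (IsLocalRing.residue_ne_zero_iff_isUnit _).mp hres
    have htop : Ideal.span {((ℓ : ℕ) : 𝒪[F])} = ⊤ := Ideal.span_singleton_eq_top.mpr hu
    haveI : Subsingleton (𝒪[F] ⧸ Ideal.span {((ℓ : ℕ) : 𝒪[F])}) :=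
      Ideal.Quotient.subsingleton_iff.mpr htop
    rw [Nat.card_of_subsingleton (0 : 𝒪[F] ⧸ Ideal.span {((ℓ : ℕ) : 𝒪[F])})]
    exact Nat.one_le_pow _ _ hℓ.pos

/-- **`#(𝒪_F / ℓᵃ 𝒪_F) ≤ (ℓᵃ) ^ c_F`** for every prime `ℓ` and every `a`
(`#(𝒪/ℓᵃ) = #(𝒪/ℓ)ᵃ`, `natCard_integer_quotient_prime_le`). [folklore] -/
private theorem natCard_integer_quotient_prime_pow_le {ℓ : ℕ} (hℓ : ℓ.Prime) (a : ℕ) :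
    Nat.card (𝒪[F] ⧸ Ideal.span {((ℓ ^ a : ℕ) : 𝒪[F])}) ≤
      (ℓ ^ a) ^ Nat.card (𝒪[F] ⧸ Ideal.span {((ringChar 𝓀[F] : ℕ) : 𝒪[F])}) := by
  rw [Nat.cast_pow, natCard_quotient_span_singleton_pow (natCast_integer_ne_zero F hℓ.ne_zero),
    ← pow_mul, mul_comm, pow_mul]
  exact Nat.pow_le_pow_left (natCard_integer_quotient_prime_le F hℓ) a

end IntegerQuotient

/-! ### Counting `Hom(M, ℤ/ℓ)` for an elementary abelian `ℓ`-group `M` -/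

section HomCount

/-- `#V^* = #V` for a finite-dimensional vector space over a finite field (`dim V^* = dim V`).
[folklore] -/
private theorem natCard_dual_eq {K V : Type*} [Field K] [AddCommGroup V] [Module K V]
    [Module.Finite K V] [Finite K] : Nat.card (Module.Dual K V) = Nat.card V := by
  have h1 : Nat.card (Module.Dual K V) = Nat.card K ^ Module.finrank K (Module.Dual K V) :=
    Module.natCard_eq_pow_finrank
  rw [h1, Subspace.dual_finrank_eq, ← Module.natCard_eq_pow_finrank]

/-- **`#Hom(M, Ω) = |M|`** for a finite abelian group `M` killed by a prime `ℓ` and `Ω ≃ ℤ/ℓ`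
(linear duality over `𝔽_ℓ`: `Hom(M, ℤ/ℓ) = M^*` has the dimension of `M`). [folklore] -/
private theorem natCard_addMonoidHom_eq_of_prime {M : Type*} [AddCommGroup M] [Finite M] {ℓ : ℕ}
    [hℓ : Fact ℓ.Prime] (hM : ∀ m : M, ℓ • m = 0) {Ω : Type*} [AddCommGroup Ω] (e : Ω ≃+ ZMod ℓ) :
    Nat.card (M →+ Ω) = Nat.card M := by
  letI inst : Module (ZMod ℓ) M := AddCommGroup.zmodModule hM
  haveI instf : Module.Finite (ZMod ℓ) M := Module.Finite.of_finite
  -- `Hom(M, Ω) ≃ Hom(M, ℤ/ℓ) ≃ Hom_{𝔽_ℓ}(M, 𝔽_ℓ)`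
  let E₁ : (M →+ Ω) ≃ (M →+ ZMod ℓ) :=
    { toFun := fun f => e.toAddMonoidHom.comp f
      invFun := fun g => e.symm.toAddMonoidHom.comp g
      left_inv := fun f => by ext m; simp
      right_inv := fun g => by ext m; simp }
  let E₂ : (M →+ ZMod ℓ) ≃ Module.Dual (ZMod ℓ) M :=
    (AddMonoidHom.toZModLinearMapEquiv ℓ).toEquiv
  rw [Nat.card_congr (E₁.trans E₂)]
  exact @natCard_dual_eq (ZMod ℓ) M _ _ inst instf _

/-- `|M| = ℓ ^ dim_{𝔽_ℓ} M` for a finite abelian group killed by the prime `ℓ`, in the form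
"`|M|` is a power of `ℓ`". [folklore] -/
private theorem exists_natCard_eq_prime_pow {M : Type*} [AddCommGroup M] [Finite M] {ℓ : ℕ}
    [hℓ : Fact ℓ.Prime] (hM : ∀ m : M, ℓ • m = 0) : ∃ a : ℕ, Nat.card M = ℓ ^ a := by
  letI : Module (ZMod ℓ) M := AddCommGroup.zmodModule hM
  haveI : Module.Finite (ZMod ℓ) M := Module.Finite.of_finite
  exact ⟨Module.finrank (ZMod ℓ) M, by rw [Module.natCard_eq_pow_finrank (K := ZMod ℓ), Nat.card_zmod]⟩

end HomCount

/-! ### The bound on `H¹` -/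

section HOne

variable (F : Type u) [Field F] [ValuativeRel F] [TopologicalSpace F] [IsNonarchimedeanLocalField F]
  [CharZero F]
variable {M : Type u} [AddCommGroup M] [TopologicalSpace M] [DiscreteTopology M] [Finite M]

/-- **`#H²(F, M) ≤ |M|`** for a finite discrete `Γ_F`-module killed by a prime `ℓ`: local Tate
duality in bidegree `(2,0)` gives `#H²(F, M) = #Hom_{Γ_F}(M, μ_ℓ)` (tree
`natCard_two_eq_natCard_invariants_homRep`), and `Hom_{Γ_F}(M, μ_ℓ) ⊆ Hom(M, μ_ℓ)` has `|M|`
elements. [cite: SerreGaloisCohomology1997, II §5.2 Thm. 2] [cite: MilneADT2006, I Cor. 2.3] -/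
theorem natCard_continuousCohomology_two_le (ρ : ContinuousRep (absoluteGaloisGroup F) ℤ M)
    {ℓ : ℕ} (hℓ : ℓ.Prime) (hM : ∀ m : M, ℓ • m = 0) :
    Finite (continuousCohomology 2 ρ.toTopRep) ∧
      Nat.card (continuousCohomology 2 ρ.toTopRep) ≤ Nat.card M := by
  haveI : Fact ℓ.Prime := ⟨hℓ⟩
  haveI : NeZero (ℓ ^ 1) := ⟨pow_ne_zero _ hℓ.ne_zero⟩
  have hM1 : ∀ m : M, ℓ ^ 1 • m = 0 := fun m => by rw [pow_one]; exact hM m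
  obtain ⟨hfin, hcard⟩ := natCard_two_eq_natCard_invariants_homRep F ρ hM1
  refine ⟨hfin, ?_⟩
  rw [hcard]
  haveI : Finite (MuCarrier F (ℓ ^ 1)) := finite_muCarrier F (ℓ ^ 1)
  -- `Hom_{Γ}(M, μ) ↪ Hom(M, μ)` and `#Hom(M, μ_ℓ) = |M|`
  have e : MuCarrier F (ℓ ^ 1) ≃+ ZMod ℓ :=
    (muEquivZMod F (ℓ ^ 1)).trans (ZMod.ringEquivCongr (pow_one ℓ)).toAddEquiv
  calc Nat.card (ρ.homRep (mu F (ℓ ^ 1))).toTopRep.ρ.invariants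
      ≤ Nat.card (HomCarrier M (MuCarrier F (ℓ ^ 1))) :=
        Nat.card_le_card_of_injective _ Subtype.val_injective
    _ = Nat.card M := natCard_addMonoidHom_eq_of_prime hM e

/-- **Uniform bound on `H¹` of finite `ℓ`-torsion modules over a `p`-adic field.**  For a
non-archimedean local field `F` of characteristic `0` with residue characteristic `p`, put
`c_F := #(𝒪_F / p𝒪_F)`.  Then for every prime `ℓ` and every finite discrete `Γ_F`-module `M` with
`ℓ M = 0`, `H¹(F, M)` is finite and

  `#H¹(F, M) ≤ |M| ^ (c_F + 2)`.

Proof: Tate's local Euler–Poincaré characteristic (hypothesis `hEP`, the tree's named fact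
`localEulerPoincareCharacteristic F`) `#H¹ = #M^Γ · #H² · #(𝒪_F/|M|)` with `#M^Γ ≤ |M|`, `#H² ≤ |M|`
(`natCard_continuousCohomology_two_le`) and, writing `|M| = ℓᵃ`, `#(𝒪_F/ℓᵃ) ≤ (ℓᵃ)^{c_F}`
(`natCard_integer_quotient_prime_pow_le`).
[cite: MilneADT2006, I §2 Thm. 2.8] [cite: SerreGaloisCohomology1997, II §5.7 Thm. 5] -/
theorem natCard_continuousCohomology_one_le_pow (hEP : localEulerPoincareCharacteristic F)
    (ρ : ContinuousRep (absoluteGaloisGroup F) ℤ M) {ℓ : ℕ} (hℓ : ℓ.Prime) (hM : ∀ m : M, ℓ • m = 0) :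
    Finite (continuousCohomology 1 ρ.toTopRep) ∧
      Nat.card (continuousCohomology 1 ρ.toTopRep) ≤
        Nat.card M ^ (Nat.card (𝒪[F] ⧸ Ideal.span {((ringChar 𝓀[F] : ℕ) : 𝒪[F])}) + 2) := by
  haveI : Fact ℓ.Prime := ⟨hℓ⟩
  set c := Nat.card (𝒪[F] ⧸ Ideal.span {((ringChar 𝓀[F] : ℕ) : 𝒪[F])}) with hc
  obtain ⟨h1, -, heq⟩ := hEP ρ
  refine ⟨h1, ?_⟩
  obtain ⟨-, h2⟩ := natCard_continuousCohomology_two_le F ρ hℓ hM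
  obtain ⟨a, ha⟩ := exists_natCard_eq_prime_pow hM
  have hinv : Nat.card ρ.toTopRep.ρ.invariants ≤ Nat.card M :=
    Nat.card_le_card_of_injective _ Subtype.val_injective
  have hO : Nat.card (𝒪[F] ⧸ Ideal.span {((Nat.card M : ℕ) : 𝒪[F])}) ≤ Nat.card M ^ c := by
    rw [ha]
    exact natCard_integer_quotient_prime_pow_le F hℓ a
  rw [← heq]
  calc Nat.card ρ.toTopRep.ρ.invariants * Nat.card (continuousCohomology 2 ρ.toTopRep) *
        Nat.card (𝒪[F] ⧸ Ideal.span {((Nat.card M : ℕ) : 𝒪[F])})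
      ≤ Nat.card M * Nat.card M * Nat.card M ^ c :=
        Nat.mul_le_mul (Nat.mul_le_mul hinv h2) hO
    _ = Nat.card M ^ (c + 2) := by ring

end HOne

end Literature.NumberTheory.GaloisRepresentations

end
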